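import Mathlib.GroupTheory.OrderOfElement
import Mathlib.Algebra.GCDMonoid.Finset
import Mathlib.Algebra.GCDMonoid.Nat
import Mathlib.Data.Nat.Choose.Dvd
import Mathlib.Data.ZMod.Basic
import Mathlib.RingTheory.Coprime.Lemmas
import Mathlib.RingTheory.PrincipalIdealDomain
import Mathlib.RingTheory.Int.Basic
import Mathlib.LinearAlgebra.Matrix.GeneralLinearGroup.Defs
import Mathlib.LinearAlgebra.Matrix.ToLin
import Mathlib.LinearAlgebra.FreeModule.Finite.Basic
import Mathlib.NumberTheory.NumberField.Basic
import HarnessLib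

/-!
# Minkowski's lemma: congruence subgroups of level `≥ 3` are torsion-free

Family `hodge` (used by the arithmetic quotients `Γ\X⁺` of period domains), layer
`Literature/GroupTheory/ArithmeticGroups`; theorems only (no definition, no named fact; D-0026).

**Minkowski (1887).** An integral matrix `g ∈ GL_N(ℤ)` of finite order with `g ≡ 1 (mod n)`, `n ≥ 3`,
is the identity; equivalently the principal congruence subgroup
`Γ(n) = ker (GL_N(ℤ) → GL_N(ℤ/n))` is torsion-free for `n ≥ 3` (and `Γ(2)` has only `2`-torsion).
This is the "lemma of Serre" of [MumfordFogartyKirwan1994, Ch. 7 §3, remark after Thm. 7.9] (rigidity of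
abelian schemes with level-`n`-structure, `n ≥ 3`; Serre, Sém. Cartan 1960/61, Exp. 17 App.), and
the reason for "let `n` be an integer `≥ 3`" in [Deligne1982HodgeCycles, proof of Thm. 4.8, p. 50]:
the level-`n` group `Γ` then acts freely on the period domain `X⁺`.

Proof (as in [Brown1982CohomologyGroups, Ch. II §4, Exercise 3]): reduce to an element `h ≠ 1` of
PRIME order `p`; write `h = 1 + t B` with `t ≥ 3` the content of `h - 1` and `B` primitive; the
binomial expansion of `(1 + tB)^p = 1` gives `p t B ≡ 0 (mod t²)`, so `t ∣ p`, `t = p ≥ 3`; then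
`p² B ≡ 0 (mod p³)` (as `p ∣ binom p 2` for odd `p`), so `p ∣ B`, contradicting primitivity.

Main statements:

* `Matrix.eq_one_of_pow_eq_one_of_dvd_sub_one` — `g : Matrix N N ℤ`, `g ^ k = 1` (`k > 0`),
  `n ∣ (g - 1) i j` for all `i j`, `3 ≤ n` ⟹ `g = 1`;
* `Matrix.GeneralLinearGroup.eq_one_of_isOfFinOrder_of_map_eq_one` /
  `Matrix.GeneralLinearGroup.torsionFree_ker_map_zmod` — the `GL_N(ℤ)` form: `Γ(n)` is torsion-free;
* `Module.End.eq_one_of_pow_eq_one_of_sub_mem_smul` — basis-free form for a finite free `ℤ`-module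
  (a lattice `V(ℤ)`): `f ^ k = 1`, `(f - 1) V(ℤ) ⊆ n V(ℤ)`, `n ≥ 3` ⟹ `f = 1` (the form used by
  Deligne: "`g` such that `(g - 1) V(ℤ) ⊂ n V(ℤ)`");
* `Matrix.eq_one_of_pow_eq_one_of_exists_eq_one_add_smul_map` — matrices over a number field `E`
  congruent to `1` modulo `n` INTEGRALLY (`g = 1 + n • A`, `A` with entries in `𝓞 E`; the tree's
  `ShimuraVarieties.IsCongruentOneMod n g`): `g ^ k = 1`, `n ≥ 3` ⟹ `g = 1` (restriction of
  scalars `𝓞 E ≅ ℤ^r`).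

## References

* [Minkowski1887] H. Minkowski, Zur Theorie der positiven quadratischen Formen, J. reine angew.
  Math. 101 (1887), 196–202 (§1).
* [Brown1982CohomologyGroups] K. S. Brown, Cohomology of Groups, GTM 87 (1982), Ch. II §4,
  Exercise 3 (p. 40).
* [MumfordFogartyKirwan1994] D. Mumford, J. Fogarty, F. Kirwan, Geometric Invariant Theory, 3rd ed.
  (1994), Ch. 7 §3, remark after Thm. 7.9 ("lemma of Serre").
* [Deligne1982HodgeCycles] P. Deligne, Hodge cycles on abelian varieties, LNM 900 (1982), proof of
  Thm. 4.8, p. 50.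
-/

namespace Literature.GroupTheory.ArithmeticGroups

open Finset

variable {N : Type*} [Fintype N] [DecidableEq N]

/-! ### Congruence modulo `n`, entrywise and via `ZMod n` -/

/-- `n ∣ (M - 1)` entrywise iff the reduction of `M` modulo `n` is the identity matrix. [folklore] -/
theorem Matrix.forall_dvd_sub_one_iff_map_eq_one (n : ℕ) (M : Matrix N N ℤ) :
    (∀ i j, (n : ℤ) ∣ (M - 1) i j) ↔ (Int.castRingHom (ZMod n)).mapMatrix M = 1 := by
  rw [← sub_eq_zero, ← map_one (Int.castRingHom (ZMod n)).mapMatrix, ← map_sub, ← Matrix.ext_iff]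
  refine forall_congr' fun i => forall_congr' fun j => ?_
  rw [RingHom.mapMatrix_apply, Matrix.map_apply, Matrix.zero_apply, Int.coe_castRingHom,
    ZMod.intCast_zmod_eq_zero_iff_dvd]

/-- Powers of a matrix `≡ 1 (mod n)` are `≡ 1 (mod n)`. [folklore] -/
theorem Matrix.forall_dvd_pow_sub_one {n : ℕ} {M : Matrix N N ℤ} (h : ∀ i j, (n : ℤ) ∣ (M - 1) i j)
    (e : ℕ) : ∀ i j, (n : ℤ) ∣ (M ^ e - 1) i j := by
  rw [Matrix.forall_dvd_sub_one_iff_map_eq_one] at h ⊢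
  rw [map_pow, h, one_pow]

/-! ### The core computation: no element `1 + tB` of prime order with `t ≥ 3`, `B` primitive -/

omit [Fintype N] [DecidableEq N] in
/-- Entries of `c • (s • M)` for `c : ℕ`, `s : ℤ`. [folklore] -/
private theorem nsmul_zsmul_apply (c : ℕ) (s : ℤ) (M : Matrix N N ℤ) (i j : N) :
    (c • (s • M)) i j = (c : ℤ) * (s * M i j) := by
  simp only [Matrix.smul_apply, smul_eq_mul, nsmul_eq_mul]

/-- **Core of Minkowski's lemma.** If `p` is prime, `t ≥ 3`, `B` is a PRIMITIVE integral matrix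
(the only integers dividing all its entries are units) and `(1 + tB)^p = 1`, contradiction:
expanding, `p t B = -Σ_{m ≥ 2} binom p m · t^m B^m ≡ 0 (mod t²)`, so `t ∣ p B`, `t ∣ p`, `t = p`;
then the right-hand side is `≡ 0 (mod p³)` (`p ∣ binom p 2`, `p` odd), so `p ∣ B`.
[cite: Brown1982CohomologyGroups, Ch. II §4 Exercise 3 (a)] [cite: Minkowski1887, §1] -/
theorem Matrix.false_of_one_add_smul_pow_prime_eq_one {p : ℕ} (hp : p.Prime) {t : ℤ} (ht : 3 ≤ t)
    {B : Matrix N N ℤ} (hB : ∀ q : ℤ, (∀ i j, q ∣ B i j) → IsUnit q)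
    (h : (1 + t • B) ^ p = 1) : False := by
  -- the binomial expansion, with the terms `m = 0, 1` split off
  set x : Matrix N N ℤ := t • B with hx
  obtain ⟨r, hr⟩ : ∃ r, p = r + 1 + 1 := ⟨p - 2, by have := hp.two_le; omega⟩
  set R : Matrix N N ℤ := ∑ m ∈ range (r + 1), (p.choose (m + 1 + 1)) • x ^ (m + 1 + 1) with hR
  have hexp : (1 + x) ^ p = R + p • x + 1 := by
    rw [add_comm (1 : Matrix N N ℤ) x, (Commute.one_right x).add_pow]
    have hterm : ∀ m ∈ range (p + 1), x ^ m * (1 : Matrix N N ℤ) ^ (p - m) * (p.choose m : Matrix N N ℤ) =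
        (p.choose m) • x ^ m := fun m _ => by
      rw [one_pow, mul_one, ← (Nat.cast_commute (p.choose m) (x ^ m)).eq, ← nsmul_eq_mul]
    rw [sum_congr rfl hterm, hr, sum_range_succ', sum_range_succ', Nat.choose_zero_right,
      Nat.choose_one_right, pow_zero, pow_one, one_smul, ← hr]
  have hkey : p • x = -R := by
    have h1 : R + p • x + 1 = 0 + 1 := by rw [← hexp, zero_add, h]
    have h2 : R + p • x = 0 := add_right_cancel h1
    exact (neg_eq_of_add_eq_zero_right h2).symm
  -- entries of `R`
  have hRij : ∀ i j, R i j = ∑ m ∈ range (r + 1),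
      (p.choose (m + 1 + 1) : ℤ) * (t ^ (m + 1 + 1) * (B ^ (m + 1 + 1)) i j) := fun i j => by
    rw [hR, Matrix.sum_apply]
    refine sum_congr rfl fun m _ => ?_
    rw [hx, smul_pow, nsmul_zsmul_apply]
  have hkey' : ∀ i j, (p : ℤ) * (t * B i j) = -R i j := fun i j => by
    have := congr_fun (congr_fun hkey i) j
    rwa [hx, nsmul_zsmul_apply, Matrix.neg_apply] at this
  have ht0 : t ≠ 0 := by omega
  -- stage 1: `t² ∣ R`, hence `t ∣ p B`
  have hst1 : ∀ i j, t ∣ p * B i j := fun i j => by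
    have hdvd : t * t ∣ R i j := by
      rw [hRij]
      refine dvd_sum fun m _ => Dvd.dvd.mul_left ?_ _
      exact Dvd.dvd.mul_right ⟨t ^ m, by ring⟩ _
    have hRe : R i j = -(t * (p * B i j)) := by rw [← neg_neg (R i j), ← hkey' i j]; ring
    have hdvd' : t * t ∣ t * (p * B i j) := by rwa [hRe, dvd_neg] at hdvd
    exact (mul_dvd_mul_iff_left ht0).1 hdvd'
  have hpZ : Prime (p : ℤ) := Nat.prime_iff_prime_int.1 hp
  -- `t = p`
  have htp : t = p := by
    by_cases hpt : (p : ℤ) ∣ t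
    · obtain ⟨s, rfl⟩ := hpt
      have hs : ∀ i j, s ∣ B i j := fun i j =>
        (mul_dvd_mul_iff_left hpZ.ne_zero).1 (hst1 i j)
      rcases Int.isUnit_iff.1 (hB s hs) with rfl | rfl
      · rw [mul_one]
      · exfalso
        have : (0 : ℤ) ≤ p := Int.natCast_nonneg p
        omega
    · exfalso
      have hcop : IsCoprime t (p : ℤ) := ((hpZ.coprime_iff_not_dvd).2 hpt).symm
      have hs : ∀ i j, t ∣ B i j := fun i j => hcop.dvd_of_dvd_mul_left (hst1 i j)
      rcases Int.isUnit_iff.1 (hB t hs) with rfl | rfl <;> omega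
  subst htp
  have hp3 : 3 ≤ p := by exact_mod_cast ht
  -- stage 2: `p³ ∣ R`, hence `p ∣ B`
  have hst2 : ∀ i j, (p : ℤ) ∣ B i j := fun i j => by
    have hdvd : (p : ℤ) * p * p ∣ R i j := by
      rw [hRij]
      refine dvd_sum fun m _ => ?_
      rcases m with _ | k
      · -- `m = 2`: `p ∣ binom p 2`
        obtain ⟨c, hc⟩ := hp.dvd_choose_self two_ne_zero (by omega)
        rw [zero_add, show (1 + 1 : ℕ) = 2 from rfl, hc, Nat.cast_mul]
        exact ⟨c * (B ^ 2) i j, by ring⟩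
      · exact Dvd.dvd.mul_left (Dvd.dvd.mul_right ⟨(p : ℤ) ^ k, by ring⟩ _) _
    have hRe : R i j = -((p : ℤ) * p * B i j) := by rw [← neg_neg (R i j), ← hkey' i j]; ring
    have hdvd' : (p : ℤ) * p * p ∣ (p : ℤ) * p * B i j := by rwa [hRe, dvd_neg] at hdvd
    have hpp0 : (p : ℤ) * p ≠ 0 := mul_ne_zero hpZ.ne_zero hpZ.ne_zero
    exact (mul_dvd_mul_iff_left hpp0).1 hdvd'
  rcases Int.isUnit_iff.1 (hB p hst2) with h1 | h1 <;> omega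

/-! ### Minkowski's lemma for integral matrices -/

/-- **Minkowski's lemma (1887).** An integral matrix of finite order which is congruent to the
identity modulo some `n ≥ 3` is the identity: `g ^ k = 1`, `k > 0`, `n ∣ (g - 1)` entrywise
⟹ `g = 1`. (Reduce to an element `h = g ^ e ≠ 1` of prime order; write `h - 1 = t B` with `t` the
content, `n ∣ t`, `B` primitive; apply `Matrix.false_of_one_add_smul_pow_prime_eq_one`.)
[cite: Minkowski1887, §1] [cite: Brown1982CohomologyGroups, Ch. II §4 Exercise 3 (b)] -/
theorem Matrix.eq_one_of_pow_eq_one_of_dvd_sub_one {g : Matrix N N ℤ} {k : ℕ} (hk : 0 < k)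
    (hg : g ^ k = 1) {n : ℕ} (hn : 3 ≤ n) (hcong : ∀ i j, (n : ℤ) ∣ (g - 1) i j) : g = 1 := by
  by_contra hne
  -- an element of prime order, still `≡ 1 (mod n)` and `≠ 1`
  have hfin : IsOfFinOrder g := isOfFinOrder_iff_pow_eq_one.2 ⟨k, hk, hg⟩
  have ho1 : orderOf g ≠ 1 := fun h1 => hne (orderOf_eq_one_iff.1 h1)
  obtain ⟨p, hp, hpo⟩ := Nat.exists_prime_and_dvd ho1
  set e : ℕ := orderOf g / p with he
  have he0 : e ≠ 0 := (Nat.div_pos (Nat.le_of_dvd hfin.orderOf_pos hpo) hp.pos).ne'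
  have helt : e < orderOf g := Nat.div_lt_self hfin.orderOf_pos hp.one_lt
  have hh1 : g ^ e ≠ 1 := pow_ne_one_of_lt_orderOf he0 helt
  have hhp : (g ^ e) ^ p = 1 := by rw [← pow_mul, Nat.div_mul_cancel hpo, pow_orderOf_eq_one]
  have hcong' : ∀ i j, (n : ℤ) ∣ (g ^ e - 1) i j := Matrix.forall_dvd_pow_sub_one hcong e
  -- content and primitive part of `A = g ^ e - 1 ≠ 0`
  set A : Matrix N N ℤ := g ^ e - 1 with hA
  have hA0 : A ≠ 0 := sub_ne_zero.2 hh1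
  obtain ⟨i₀, j₀, hij₀⟩ : ∃ i j, A i j ≠ 0 := by
    by_contra hall
    push Not at hall
    exact hA0 (Matrix.ext fun i j => by rw [hall i j, Matrix.zero_apply])
  set f : N × N → ℤ := fun ij => A ij.1 ij.2 with hf
  have hs : (univ : Finset (N × N)).Nonempty := ⟨(i₀, j₀), mem_univ _⟩
  set t : ℤ := (univ : Finset (N × N)).gcd f with ht
  have ht0 : t ≠ 0 := fun h0 => hij₀ (Finset.gcd_eq_zero_iff.1 h0 (i₀, j₀) (mem_univ _))
  have htnn : 0 ≤ t := Int.nonneg_of_normalize_eq_self Finset.normalize_gcd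
  have htpos : 0 < t := lt_of_le_of_ne htnn (Ne.symm ht0)
  have hnt : (n : ℤ) ∣ t := Finset.dvd_gcd fun b _ => hcong' b.1 b.2
  have ht3 : 3 ≤ t := le_trans (by exact_mod_cast hn) (Int.le_of_dvd htpos hnt)
  obtain ⟨b, hb, hbg⟩ := Finset.extract_gcd f hs
  set B : Matrix N N ℤ := Matrix.of fun i j => b (i, j) with hB
  have hAB : A = t • B := by
    ext i j
    rw [Matrix.smul_apply, smul_eq_mul, hB, Matrix.of_apply]
    exact hb (i, j) (mem_univ _)
  have hprim : ∀ q : ℤ, (∀ i j, q ∣ B i j) → IsUnit q := fun q hq =>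
    isUnit_of_dvd_one (hbg ▸ Finset.dvd_gcd fun ij _ => by simpa [hB] using hq ij.1 ij.2)
  have hge : g ^ e = 1 + t • B := by rw [← hAB, hA, add_sub_cancel]
  rw [hge] at hhp
  exact Matrix.false_of_one_add_smul_pow_prime_eq_one hp ht3 hprim hhp

/-- Minkowski's lemma, `IsOfFinOrder` form. [cite: Minkowski1887, §1] -/
theorem Matrix.eq_one_of_isOfFinOrder_of_dvd_sub_one {g : Matrix N N ℤ} (hg : IsOfFinOrder g) {n : ℕ}
    (hn : 3 ≤ n) (hcong : ∀ i j, (n : ℤ) ∣ (g - 1) i j) : g = 1 := by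
  obtain ⟨k, hk, hgk⟩ := isOfFinOrder_iff_pow_eq_one.1 hg
  exact Matrix.eq_one_of_pow_eq_one_of_dvd_sub_one hk hgk hn hcong

/-- Minkowski's lemma, `ZMod` form: `g ^ k = 1`, `k > 0`, `g mod n = 1`, `n ≥ 3` ⟹ `g = 1`.
[cite: Minkowski1887, §1] [cite: Brown1982CohomologyGroups, Ch. II §4 Exercise 3 (b)] -/
theorem Matrix.eq_one_of_pow_eq_one_of_map_zmod_eq_one {g : Matrix N N ℤ} {k : ℕ} (hk : 0 < k)
    (hg : g ^ k = 1) {n : ℕ} (hn : 3 ≤ n) (hcong : (Int.castRingHom (ZMod n)).mapMatrix g = 1) :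
    g = 1 :=
  Matrix.eq_one_of_pow_eq_one_of_dvd_sub_one hk hg hn
    ((Matrix.forall_dvd_sub_one_iff_map_eq_one n g).2 hcong)

/-! ### The principal congruence subgroup `Γ(n) ≤ GL_N(ℤ)` is torsion-free for `n ≥ 3` -/

/-- **`Γ(n) = ker (GL_N(ℤ) → GL_N(ℤ/n))` is torsion-free for `n ≥ 3`**: an element of finite order
of `GL_N(ℤ)` reducing to `1` modulo `n ≥ 3` is `1`.
[cite: Minkowski1887, §1] [cite: Brown1982CohomologyGroups, Ch. II §4 Exercise 3 (b)] -/
theorem Matrix.GeneralLinearGroup.eq_one_of_isOfFinOrder_of_map_eq_one {n : ℕ} (hn : 3 ≤ n)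
    {g : GL N ℤ} (hg : IsOfFinOrder g)
    (hker : Matrix.GeneralLinearGroup.map (Int.castRingHom (ZMod n)) g = 1) : g = 1 := by
  obtain ⟨k, hk, hgk⟩ := isOfFinOrder_iff_pow_eq_one.1 hg
  have hgk' : (g : Matrix N N ℤ) ^ k = 1 := by
    rw [← Units.val_pow_eq_pow_val, hgk, Units.val_one]
  have hmap : (Int.castRingHom (ZMod n)).mapMatrix (g : Matrix N N ℤ) = 1 := by
    have := congr_arg (fun u : GL N (ZMod n) => (u : Matrix N N (ZMod n))) hker
    simpa [Matrix.GeneralLinearGroup.map] using this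
  exact Units.ext (Matrix.eq_one_of_pow_eq_one_of_map_zmod_eq_one hk hgk' hn hmap)

/-- **Minkowski: `Γ(n)` is torsion-free (`n ≥ 3`)**, stated on the kernel of the reduction map.
[cite: Minkowski1887, §1] [cite: Brown1982CohomologyGroups, Ch. II §4 Exercise 3 (b)] -/
theorem Matrix.GeneralLinearGroup.torsionFree_ker_map_zmod {n : ℕ} (hn : 3 ≤ n) :
    ∀ g ∈ (Matrix.GeneralLinearGroup.map (n := N) (Int.castRingHom (ZMod n))).ker,
      IsOfFinOrder g → g = 1 := fun _ hg hfin =>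
  Matrix.GeneralLinearGroup.eq_one_of_isOfFinOrder_of_map_eq_one hn hfin ((MonoidHom.mem_ker).1 hg)

/-! ### Basis-free form: endomorphisms of a lattice -/

/-- **Minkowski's lemma for a lattice.** Let `V(ℤ)` be a finite free `ℤ`-module and `f` an
endomorphism of finite order (`f ^ k = 1`, `k > 0`) with `(f - 1) V(ℤ) ⊆ n V(ℤ)` for some `n ≥ 3`
(Deligne: "`g` such that `(g - 1)V(ℤ) ⊂ nV(ℤ)`"). Then `f = 1`.
[cite: Minkowski1887, §1] [cite: Deligne1982HodgeCycles, proof of Thm. 4.8, p. 50] -/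
theorem Module.End.eq_one_of_pow_eq_one_of_sub_mem_smul {M : Type*} [AddCommGroup M] [Module.Free ℤ M]
    [Module.Finite ℤ M] {f : M →ₗ[ℤ] M} {k : ℕ} (hk : 0 < k) (hf : f ^ k = 1) {n : ℕ} (hn : 3 ≤ n)
    (hcong : ∀ x, ∃ y, f x - x = (n : ℤ) • y) : f = 1 := by
  classical
  let b := Module.Free.chooseBasis ℤ M
  set G : Matrix _ _ ℤ := LinearMap.toMatrixAlgEquiv b f with hG
  have hGk : G ^ k = 1 := by rw [hG, ← map_pow, hf, map_one]
  have hGc : ∀ i j, (n : ℤ) ∣ (G - 1) i j := fun i j => by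
    obtain ⟨y, hy⟩ := hcong (b j)
    refine ⟨b.repr y i, ?_⟩
    rw [hG, ← map_one (LinearMap.toMatrixAlgEquiv b), ← map_sub, LinearMap.toMatrixAlgEquiv_apply,
      LinearMap.sub_apply, Module.End.one_apply, hy, map_smul, Finsupp.smul_apply, smul_eq_mul]
  have hG1 : G = 1 := Matrix.eq_one_of_pow_eq_one_of_dvd_sub_one hk hGk hn hGc
  apply (LinearMap.toMatrixAlgEquiv b).injective
  rw [← hG, hG1, map_one]

/-! ### Matrices over a number field congruent to `1` modulo `n` integrally -/

section NumberField

open NumberField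

variable {E : Type*} [Field E] [NumberField E] {m : Type*} [Fintype m] [DecidableEq m]

omit [NumberField E] in
/-- Restriction of scalars: the matrix algebra over `𝓞 E` acts `ℤ`-linearly on the lattice
`(𝓞 E)^m`; powers are respected. [folklore] -/
private theorem restrictScalars_toLin'_pow (g₀ : Matrix m m (𝓞 E)) (j : ℕ) :
    ((Matrix.toLin' g₀).restrictScalars ℤ) ^ j = (Matrix.toLin' (g₀ ^ j)).restrictScalars ℤ := by
  induction j with
  | zero =>
    rw [pow_zero, pow_zero, Matrix.toLin'_one]
    rfl
  | succ j ih =>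
    rw [pow_succ, ih, pow_succ, Matrix.toLin'_mul]
    rfl

/-- **Minkowski's lemma over a number field.** A matrix `g` over a number field `E` of finite
order (`g ^ k = 1`, `k > 0`) which is congruent to `1` modulo `n ≥ 3` INTEGRALLY — `g = 1 + n • A`
for a matrix `A` with entries in `𝓞 E` (the tree's `ShimuraVarieties.IsCongruentOneMod n g`) — is
the identity. (View `g` as a `ℤ`-linear automorphism of the lattice `(𝓞 E)^m ≅ ℤ^{m[E:ℚ]}`, on which
it is `≡ 1 (mod n)`, and apply `Module.End.eq_one_of_pow_eq_one_of_sub_mem_smul`.)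
[cite: Minkowski1887, §1] [cite: Brown1982CohomologyGroups, Ch. II §4 Exercise 3 (b)] -/
theorem Matrix.eq_one_of_pow_eq_one_of_exists_eq_one_add_smul_map {g : Matrix m m E} {k : ℕ}
    (hk : 0 < k) (hg : g ^ k = 1) {n : ℕ} (hn : 3 ≤ n)
    (hcong : ∃ A : Matrix m m (𝓞 E), g = 1 + n • A.map (algebraMap (𝓞 E) E)) : g = 1 := by
  obtain ⟨A, rfl⟩ := hcong
  set g₀ : Matrix m m (𝓞 E) := 1 + n • A with hg₀
  have hmapg₀ : (algebraMap (𝓞 E) E).mapMatrix g₀ = 1 + n • A.map (algebraMap (𝓞 E) E) := by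
    rw [hg₀, map_add, map_one, map_nsmul, RingHom.mapMatrix_apply]
  have hinj : Function.Injective ((algebraMap (𝓞 E) E).mapMatrix : Matrix m m (𝓞 E) →+* Matrix m m E) :=
    fun X Y hXY =>
    Matrix.map_injective (RingOfIntegers.coe_injective (K := E))
      (by simpa only [RingHom.mapMatrix_apply] using hXY)
  -- `g₀ ^ k = 1` over `𝓞 E`
  have hg₀k : g₀ ^ k = 1 := hinj (by rw [map_pow, hmapg₀, hg, map_one])
  -- the `ℤ`-linear endomorphism of the lattice `(𝓞 E)^m`
  set f : (m → 𝓞 E) →ₗ[ℤ] (m → 𝓞 E) := (Matrix.toLin' g₀).restrictScalars ℤ with hf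
  have hfk : f ^ k = 1 := by
    rw [hf, restrictScalars_toLin'_pow, hg₀k, Matrix.toLin'_one]
    rfl
  have hfc : ∀ x, ∃ y, f x - x = (n : ℤ) • y := fun x => ⟨A.mulVec x, by
    rw [hf, LinearMap.restrictScalars_apply, Matrix.toLin'_apply, hg₀, Matrix.add_mulVec,
      Matrix.one_mulVec, Matrix.smul_mulVec, add_sub_cancel_left, natCast_zsmul]⟩
  have hf1 : f = 1 := Module.End.eq_one_of_pow_eq_one_of_sub_mem_smul hk hfk hn hfc
  -- back to matrices
  have hlin : Matrix.toLin' g₀ = Matrix.toLin' (1 : Matrix m m (𝓞 E)) := by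
    apply LinearMap.restrictScalars_injective ℤ
    rw [← hf, hf1, Matrix.toLin'_one]
    rfl
  have hg₀1 : g₀ = 1 := (Matrix.toLin' : Matrix m m (𝓞 E) ≃ₗ[𝓞 E] _).injective hlin
  rw [← hmapg₀, hg₀1, map_one]

end NumberField

end Literature.GroupTheory.ArithmeticGroups
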